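import Summits.HodgeConjecture.HodgeConjecture.Theorems.F0P2iRIGinfArith              -- ★ p818525: row B1 `apply_inr_principal_eq_one_of_hasUnitaryArchType_zero`
import Literature.NumberTheory.Automorphic.Liu2021.FinAdelicCheckDescent               -- ★ p817794: `isAutomorphicOneChar_of_comp_finAdelicCheck_eq`
import Literature.NumberTheory.Automorphic.Liu2021.LemD1SplitPlaceHeckeEigenvaluesJunction  -- ★ `Def411WeilCarriers.complexConj_mul_complexConj'` (P2 `hcc` of record)
import Literature.NumberTheory.Automorphic.IdeleClassCharacterHecke                    -- ★ `toHeckeCharacter`, `hasUnitaryArchType_toHeckeCharacter_iff`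
import HarnessLib

/-!
# FLOOR-0 P2 — PKΠ RUNG 4, ROW «RIG∞-GLUE»: the two name-free glue lemmas between RIG∞″ and the GRD witness (in-house, S; theorems only)

Cell hodgecm-mathlib (D-0151), FLOOR 0, programme P2 (theta ∕ `hdictE`); crux item H413 = stmt-HodgeConjecture-24833 (`HCCMUnconditional.H413`);
sub-line `Cruxes/H413/Lines/F0_P2PKPiRung4.lean` (F0P2-plan (g6)).  Row «RIG∞-GLUE» dealt 2026-08-31T09:36:46Z to seat B-p18 (g26): the two
NAME-FREE glue lemmas through which the GRD witness (F0P2-p01), the (N)∕(S) assembly (A-p17) and the v1.4 head consume ★ RIG∞″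
(`Theorems/F0P2iRIGinfArith.lean`, p818525).  THEOREMS ONLY (no `def`, no instance, no notation, no named fact, no `sorry`); never imports a
`Cruxes/…/Lines` module; `--supports stmt-HodgeConjecture-24833 --as helper`.  HC_CM is proved only modulo the printed citations until rung 0
closes; this file discharges none of them.

* (G-μ′) **`hasWeight_one_of_hasUnitaryArchType_toHeckeCharacter`** — an idèle-CLASS character `μ₁ : C_L →ₜ* S¹` whose Hecke character
  `toHeckeCharacter L μ₁` has unitary archimedean type `(m, 0)` with `|m_w| = 1` at every place has WEIGHT ONE, `HasWeight L μ₁ 1` ([Liu2021] Def. 4.3;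
  ★ dictionary `hasUnitaryArchType_toHeckeCharacter_iff`).  With RIG∞″'s first two conjuncts this is `HasWeight L μ 1` for the GRD character
  `μ̃ = η̃⁻¹ψ̃⁻¹μω`.
* (G-χ′) **`isAutomorphicOneChar_of_finAdelicCheck_eq_hecke`** — a homomorphism `χ` on `U(1)(𝔸_{L⁺,f})` with `χ(z/z̄) = ν((1_∞, z))` for a Hecke
  character `ν` of `L` of unitary archimedean type `(0,0)` is an AUTOMORPHIC character of `L¹ \ U(1)(𝔸_{L⁺,f})` ([Liu2021] Def. 4.11): ★ B-p12's
  automorphy transfer `isAutomorphicOneChar_of_comp_finAdelicCheck_eq` fed with `ν_f := ν ∘ (1_∞, ·)` (continuous, (G-ν)) and row B1 of RIG∞″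
  (`ν_f` kills the principal finite idèles).  The hypothesis `hχ` is the DICTIONARY (χ_f) clause of the P2 letters in their currency
  (`finAdelicCheck L⁺ L c̄ (Def411WeilCarriers.complexConj_mul_complexConj' L)`), so the GRD witness feeds it by `exact`.
* (G-ν) **`continuous_hecke_comp_inr`** — `z ↦ ν((1_∞, z))` is continuous on `(𝔸_L^∞)ˣ`.

## References
* [Liu2021] Y. Liu, Camb. J. Math. 9 (2021): Def. 4.3 (weight of a conjugate self-dual character), Def. 4.11 (l. 2090) (automorphic characters of
  `E¹\(𝔸_E^∞)¹`).
* [Rogawski1990] J. Rogawski, Ann. of Math. Stud. 123 (1990): §12.3 pp. 174–178 (the characters `η̃`, `ψ̃`, `μ` at infinity).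
* [WeilBNT1967] A. Weil, *Basic Number Theory* (1967): Ch. VII §3 (characters of the idèle class group).
-/

set_option autoImplicit false
-- the mandated namespace has the single-problem summit's repeated segment (`HodgeConjecture.HodgeConjecture`)
set_option linter.dupNamespace false

noncomputable section

open NumberField IsDedekindDomain

namespace Summit.HodgeConjecture.HodgeConjecture.Cruxes.H413.F0P2iRIGinfGlue

open Literature.NumberTheory.GaloisRepresentations
open Literature.NumberTheory.Automorphic Literature.NumberTheory.Automorphic.IdeleClassGroup
open Literature.NumberTheory.Automorphic.Liu2021 Literature.NumberTheory.Automorphic.Liu2021.Def411WeilCarriers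
open Summit.HodgeConjecture.HodgeConjecture.Cruxes.H413.F0P2iRIGinfArith

/-! ## (G-μ′) weight one from a unitary archimedean type of weight one -/

/-- **(G-μ′)** An idèle-class character `μ₁` whose Hecke character has unitary archimedean type `(m, 0)` with `𝔴(m)_w = |m_w| = 1` for every `w`
has weight one: `HasWeight L μ₁ 1` (★ `hasUnitaryArchType_toHeckeCharacter_iff` turns the type into an ∞-type `m` of `μ₁`; `weight m = 1` by
`funext`). [cite: Liu2021, Def. 4.3] -/
theorem hasWeight_one_of_hasUnitaryArchType_toHeckeCharacter (L : Type) [Field L] [NumberField L] [IsCMField L]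
    (μ1 : IdeleClassGroup L →ₜ* Circle) (m : InfinitePlace L → ℤ)
    (h : (toHeckeCharacter L μ1).HasUnitaryArchType m (fun _ => 0)) (hm : ∀ w, IdeleClassGroup.weight m w = 1) :
    HasWeight L μ1 1 :=
  ⟨m, (hasUnitaryArchType_toHeckeCharacter_iff L μ1 m).1 h, funext hm⟩

/-! ## (G-ν) continuity of `z ↦ ν((1_∞, z))` -/

/-- **(G-ν)** For a Hecke character `ν` of `L`, the finite-idèle character `z ↦ ν((1_∞, z))` is continuous (`ν` is continuous and
`z ↦ (1_∞, z)` is a continuous homomorphism `(𝔸_L^∞)ˣ → 𝕀_L`). [cite: WeilBNT1967, Ch. VII §3] -/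
theorem continuous_hecke_comp_inr (L : Type) [Field L] [NumberField L] (ν : HeckeCharacter L) :
    Continuous fun z : (FiniteAdeleRing (𝓞 L) L)ˣ =>
      ν (Units.map (N := AdeleRing (𝓞 L) L) (MonoidHom.inr (InfiniteAdeleRing L) (FiniteAdeleRing (𝓞 L) L)) z) :=
  (map_continuous ν).comp (Continuous.units_map _ (continuous_const.prodMk continuous_id))

/-! ## (G-χ′) automorphy of the descended centre character -/

/-- **(G-χ′)** Let `ν` be a Hecke character of `L` of unitary archimedean type `(0, 0)` and `χ` a homomorphism on the norm-one finite idèles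
`U(1)(𝔸_{L⁺,f})` with `χ(z/z̄) = ν((1_∞, z))` for every finite idèle `z` of `L` (the DICTIONARY (χ_f) clause).  Then `χ` is an automorphic
character of `L¹ \ U(1)(𝔸_{L⁺,f})` (★ `IsAutomorphicOneChar`): ★ automorphy transfer `isAutomorphicOneChar_of_comp_finAdelicCheck_eq` with
`ν_f := ν ∘ (1_∞, ·)`, continuous by (G-ν) and trivial on the principal finite idèles by row B1 of RIG∞″
(`apply_inr_principal_eq_one_of_hasUnitaryArchType_zero`). [cite: Liu2021, Def. 4.11 (l. 2090)] [cite: WeilBNT1967, Ch. VII §3] -/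
theorem isAutomorphicOneChar_of_finAdelicCheck_eq_hecke (L : Type) [Field L] [NumberField L] [IsCMField L]
    (ν : HeckeCharacter L) (h0 : ν.HasUnitaryArchType (fun _ => 0) (fun _ => 0))
    (χ : UnitaryGroup.finAdelicOne (↥(maximalRealSubfield L)) L (IsCMField.complexConj L) →* ℂˣ)
    (hχ : ∀ z : (FiniteAdeleRing (𝓞 L) L)ˣ,
      χ (finAdelicCheck (↥(maximalRealSubfield L)) L (IsCMField.complexConj L)
          (Def411WeilCarriers.complexConj_mul_complexConj' L) z) =
        ν (Units.map (N := AdeleRing (𝓞 L) L) (MonoidHom.inr (InfiniteAdeleRing L) (FiniteAdeleRing (𝓞 L) L)) z)) :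
    IsAutomorphicOneChar (↥(maximalRealSubfield L)) L (IsCMField.complexConj L) χ := by
  -- the finite-idèle character `ν_f := ν ∘ (1_∞, ·)` as a monoid hom
  let νf : (FiniteAdeleRing (𝓞 L) L)ˣ →* ℂˣ :=
    ν.toContinuousMonoidHom.toMonoidHom.comp
      (Units.map (N := AdeleRing (𝓞 L) L) (MonoidHom.inr (InfiniteAdeleRing L) (FiniteAdeleRing (𝓞 L) L)))
  have hcomp : χ.comp (finAdelicCheck (↥(maximalRealSubfield L)) L (IsCMField.complexConj L)
      (Def411WeilCarriers.complexConj_mul_complexConj' L)) = νf :=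
    MonoidHom.ext fun z => hχ z
  have hν : Continuous νf := continuous_hecke_comp_inr L ν
  have hνE : ∀ b : Lˣ, νf (Units.map (algebraMap L (FiniteAdeleRing (𝓞 L) L)).toMonoidHom b) = 1 :=
    fun b => apply_inr_principal_eq_one_of_hasUnitaryArchType_zero L ν h0 b
  exact isAutomorphicOneChar_of_comp_finAdelicCheck_eq (↥(maximalRealSubfield L)) L (IsCMField.complexConj L)
    (Def411WeilCarriers.complexConj_mul_complexConj' L) (IsCMField.complexConj_ne_one (K := L)) hcomp hν hνE

end Summit.HodgeConjecture.HodgeConjecture.Cruxes.H413.F0P2iRIGinfGlue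

end
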